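import Summits.BirchSwinnertonDyer.BirchSwinnertonDyer.Theorems.PrintCFramBottomClassIndexLawFiveLeHeegnerFieldSupplySixPrimes
import Summits.BirchSwinnertonDyer.BirchSwinnertonDyer.Theorems.PrintCFramBottomClassIndexLawFiveLeEisensteinEndStateV19CurveFree
import HarnessLib

/-!
# Crux `PrintCFram.BottomClassIndexLawFiveLe` (stmt-BirchSwinnertonDyer-20372) — line «legendre-half-transfer» (publish-only, W-79)

Ideator seat `bsd-idea-7` (lens «complete» = programme completion), CRUX-LEVEL ONLY; g14 filed v1 (sha16 `f5995901f65c4015`), g15 files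
this **v2: critic V#131 (idea-crit-10 g4, PASS-WITH-PRICE) prices P1–P3 PAID in the docstrings below, P4 paid as evidence + ONE kit job spec
(`Lines/legendre-half-transfer-P4-jobspec.md`), and the line REBASED on REGISTRY v20** («ELEMENTARY CURRENCY», LEAD `bsd-line-cfram-p1` g12,
`Lines/eisenstein_resource_bdp_line.lean` sha16 `dd3b8a563636fe13`): the four non-analytic stubs are v20's VERBATIM (`stub_prints5`, `stub_krizLi`,
`stub_bsdp_of_level`, `stub_bsdp_of_sha`) and v20's ONE analytic research stub `stub_bernoulliSupplySix` = `(P⁶)` is SPLIT into T_A ∧ T_B — this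
file is «v20 with `(P⁶)` split along the prime `p`», a candidate RESHAPE offered to the LEAD at a cycle boundary (publish-only, W-79; the registry
is untouched). THEOREM-SHAPED STUBS ONLY (`sorry` inside `stub_*` and nowhere else); the kernel `BottomClassIndexLawFiveLe_of` concludes the crux
BY NAME. **v3 (g15, 2026-08-29): T_A is DERIVED (`seedAwayFromP_of_dichotomy`) by a case split on the decidable predicate `D_p(m)` («some odd
`q ∣ m` has `q ≡ ±1 (mod p)`») from `stub_seedAwayFromP_offD` (DEVICE-M: constant-term device, P4 §F.2/F.6 — 58/65 window classes) and
`stub_seedAwayFromP_onD` (RESEARCH-S: class form cuspidal mod `p`, 7/65 window classes, all seeded); T_B is relabelled DERIVED = (AtP⁶) =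
registry v21 `stub_atP` (LEAD g12 Prop. 3.4, checked in P4 §C); registry v21's `stub_seedOff` is T_A off the locus `L` — the same dichotomy applies
to it verbatim.** BSD is not proved by any of this; the crux stays OPEN.

THE MOVE. Width seat w8 g4 reduced Stub C to the curve-free supply statement `(P)` / `(P⁶)` (file
`Theorems/PrintCFramBottomClassIndexLawFiveLeHeegnerFieldSupplySixPrimes.lean`, `stubC_of_splitPrimes_bernoulliUnit_six`): for each of the six
leaf primes `p`, each primitive quadratic `χ` of conductor `m ⊥ p` (the class character `χ_{e*}`) and `k ∈ {(p+1)/4, (3p−1)/4}`, SOME imaginary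
quadratic `K` in which every prime `q ∣ p·m` splits has a `p`-adic UNIT field factor `B_{k,(χ ε_K)~}/k`. w8 g4 §4 names the one obstruction to
the modular-forms (Eisenstein constant term / Sturm) proof: the splitting condition AT `p` forces level divisible by `p²`, where the integral
`q`-expansion principle is unavailable. This line splits `(P⁶)` into

* `seedAwayFromP_of_dichotomy` **(T_A; v3: derived from `stub_seedAwayFromP_offD` (DEVICE-M, constant-term device) and `stub_seedAwayFromP_onD`
  (RESEARCH-S) by a case split on `D_p(m)`)** — `(P⁶)` with the splitting condition imposed only at the primes of `m` (level prime to `p`: the regime of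
  Wiles 2015 Thm. 0.0.1 / Beckwith 2017 for `k = 1`, of Bruinier 1999 / Ono–Skinner 1998 / Byeon 2003 for `k ≥ 2`, and of the Eisenstein
  constant-term computation at the cusps of `Γ₀(4m²)`), and
* `stub_legendreHalfTransfer` **(T_B)** — the LEGENDRE-HALF TRANSFER: a unit field factor on some admissible `K₀` (any behaviour at `p`)
  forces one on an admissible `K` with `p` split. Lever: «`p` splits in `ℚ(√D)`» is «`(N/p) = (e*/p)`» for the index `N = |e*·D|` of the
  Cohen–Eisenstein series `H_k = Σ_N L(1−k, χ_{D₀(N)})·T_k(N) q^N ∈ M_{k+1/2}(Γ₀(4))` (holomorphic for `k ≥ 2`), and `(N/p) ≡ N^{(p−1)/2}`, so the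
  projector onto a Legendre half is `½(1 ± ε·θ^{(p−1)/2})` MODULO `p`, Ramanujan's `θ = q d/dq`, at level PRIME TO `p` (Serre–Katz): the
  condition at `p` costs weight/filtration, not level. `¬T_B` for one `(p, e*, k)` says the square-class component `F` of `H_k ⊗ (local
  conditions at q ∣ m)` satisfies `θ^{(p−1)/2}F ≡ −ε θ^{p−1}F (mod p)` with `F ≢ 0`, equivalently ONE Ramanujan-type congruence
  `a_F(pn + b) ≡ 0 (mod p)` with `p ∤ b` (it propagates to the whole Legendre half by multiplying with `1 ∓ εθ^{(p−1)/2}`) — exactly the shape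
  whose NON-EXISTENCE the theta-cycle / filtration calculus decides for the partition function and other eta-quotients (Kiming–Olsson 1992,
  Ahlgren–Boylan 2003, Dewar 2011, Radu 2012; Beckwith–Raum–Richter 2022 Thms 1–4 for the `k = 1` analogue — Hurwitz class numbers — where
  `ℓ ∣ a ⟹ ℓ ∣ b`; Raum 2022 Thm. 1 / §4.1: a congruence on a non-trivial union of square classes mod `ℓ` is a `θ`-type or `U_ℓ`-type congruence and
  forces «gargantuan» filtration). PROGRAMME TO COMPLETE (lens): run that calculus for the half-integral weight `k + 1/2`,
  `k ∈ {(p+1)/4, (3p−1)/4}` (first theta-cycle drop at step `(p+1)/4 < (p−1)/2`), level `4·m'²` prime to `p`.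
  Integral-weight toy (desk, NOT typed): for `f ≢ 0 (mod p)` of filtration `2 ≤ w < (p+1)/2` and level prime to `p`, both Legendre halves of
  `f` are `≢ 0`; the first genuine exception is `w = (p+1)/2` (`E_{(p+1)/2} ≡` the weight-one theta series of `ℚ(√−p)`), which is the Shimura
  weight `2k ≡ (p+1)/2 (mod p−1)` of our `k` — so the half-integral statement is research, not routine, and is where this line can die.

NUMERICS (desk, pure Python, exact Bernoulli arithmetic mod `p`, engine cross-checked on `L(−1,χ_5) = −2/5, L(−1,χ_8) = −1, L(−4,χ_{−8}) = 57,
H(2,5) = −2/5, H(2,36) = −175/12`; folder `g14/`): for `p ∈ {7, 11, 19, 43, 67}`, both `k`, all fundamental `D₀` with `|D₀| ≤ 6000–8000`: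
(a) unit field factors are abundant on BOTH Legendre halves (e.g. `p = 43, k = 11`: 1072/1186 with `(|D₀|/p) = +1`, 1094/1188 with `−1`;
`p = 67, k = 50`: 1158/1190 and 1177/1205); (b) congruence hunt `H(k, p·m'·n + b) ≡ 0 (mod p)`, `p ∤ b`, `m' ≤ 40` (`p ≤ 19`) resp. `≤ 10`: the ONLY
candidates are the trivial Hecke-eigenvalue congruences on NON-fundamental square classes (`p = 7, k = 2`: `N ≡ 4 (32)`, eigenvalue
`1 + 2³ − 2 = 7`; `p = 7, k = 5`: `N ≡ 28 (32)`, `513 − 16 = 7·71`; `p = 11, k = 3`: `N ≡ 9 (27)`, `σ₅(3) + 9 = 11·23`; `p = 11, k = 8`: `N ≡ 18 (27)`) —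
none on a union of unit square classes, none separating the Legendre halves, none at all for `p = 19, 43, 67`; (c) ANOMALY recorded for the
critic: the zero density of `L(1−k, χ_{D₀}) (mod p)` over imaginary `D₀` is `1/p` at control weights (`p = 43`: `k = 7, 9, 13, 15, 21` give
0.028/0.026/0.024/0.021/0.017 vs `1/43 = 0.023`) but `0.085` at `k = 11 = (p+1)/4` (likewise `p = 19`: 0.117 at `k = 5` vs 0.046–0.054 at
`k = 3, 7, 9`; `p = 67`: 0.067 at `k = 17` vs 0.017 at `k = 15, 19`), with non-zero residues equidistributed — consistent with the Kriz–Li /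
Mazur–Wiles reading of these and only these weights (`φ²ω = ε_{−p}`): the excess zeros are the `p`-Selmer events (rank ≥ 2, `Ш[p]`, `p`-divisible
generator) in the quadratic-twist family of the CM curve `A(p)`; it does not threaten T_A/T_B (existence of ONE unit per class), and it is the
numerical shadow of B1's subfamilies.
NUMERICS v2 (g15, engine `cohen_fft.py`: every `H(k,N) mod p`, `N ≤ X`, computed from `H_k ∈ M_{k+1/2}(Γ₀(4))` via the unitriangular Koblitz
basis `θ^{2k+1−4j}F^j` and Sturm, exact NTT arithmetic, re-verified against the exact definition on each run; `Lines/legendre-half-transfer-P4.md`):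
all twelve `(p,k)` incl. `p = 163`; `p ≤ 67`: `N ≤ 2·10⁵`, every `m' ≤ 200` (`≤ 186` at `p = 67`); `p = 163`: `N ≤ 1.2·10⁵ / 5·10⁴`, `m' ≤ 40 / 12`:
0 genuine congruences (1188 primitive candidates, ALL Hecke-type on classes without fundamental members — BRR 2022 Thm 4 case (ii) shape), 0 one-sided
square classes among 566 (`m' ≤ 24`); Legendre-half unit fractions 0.83–0.99 and symmetric to ±1 %; the CM-weight zero excess persists
(`p = 163, k = 41`: 0.037/0.027 vs `1/p = 0.006`). Residual range (`N ≤ 2·10⁶`, `m' ≤ 400`) = ONE kit job spec in the P4 file.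

Composition (v2): `(T_A ∧ T_B) ⟹ (P⁶)` (`splitPrimes_six_of_seed_of_transfer`, pure logic) ⟹ Stub C (`stubC_of_splitPrimes_bernoulliUnit_six`,
w8 g4, p677555) ⟹ with `stub_prints5`, `stub_krizLi`, `stub_bsdp_of_level`, `stub_bsdp_of_sha` VERBATIM from registry v20, the crux through LEAD g11's
END STATE in binders (`EisensteinEndStateV19Binders.bottomClassIndexLawFiveLe_of_prints4_of_mazurWiles_of_krizLi_of_cover_of_level_of_sha`, p677037)
— literally v20's one-line composition with `stub_bernoulliSupplySix` replaced by `splitPrimes_six_of_seed_of_transfer hA hB`.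
Card: `Lines/legendre-half-transfer.md`; instrument: `Lines/legendre-half-transfer-P4.md` (executed hunt + ONE kit job spec); crux idea:
`Ideas/legendre-half-transfer.md`; engines + tables (crux evidence, = HOME `pub/ideators/bsd-idea-7/g14|g15/`): `cohen_modp.py` (g14, exact desk
engine), `g14-numerics-tables.txt`, `cohen_fft.py` (g15: all `H(k,N) mod p`, `N ≤ X`, from `H_k` itself via the Koblitz basis `θ^{2k+1−4j}F^j` + Sturm,
exact NTT arithmetic, self-verified), `cohen_fft-runs.txt`. References: [Cohen1975] Math. Ann. 217 (H_k); [KrizLi2019]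
Thm. 1.20; Wiles 2015 (arXiv:1409.6281) Thm. 0.0.1; Beckwith 2017; Bruinier 1999 (Duke 98) Thm. 1 / Ono–Skinner 1998 (Ann. Math. 147); Kiming–Olsson 1992
(Arch. Math. 59); Ahlgren–Boylan 2003 (Invent. 153; not held, acq-14325) / 2005 (Math. Ann. 331); Bruinier–Ono 2003 (J. Number Theory 99); Dewar 2011;
Radu 2012/2013; Beckwith–Raum–Richter 2022 (Adv. Math.; arXiv:2203.11273, HELD: [corpus: paper:arxiv-2203.11273 pp. 2–3]) Thms 1–4; Raum 2022
(arXiv:2010.06272) Thm. 1, §4.1; Raum 2023 (Forum Math., doi:10.1515/forum-2022-0041; not held, `lit want` acq-14338); Katz 1977 / Jochnowitz 1982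
(theta cycles; [corpus: book:cornell1997 p.297]); Ramsey 2006 (Ann. Inst. Fourier 56; arXiv:0906.3238). BSD is not proved by any of this.
-/

set_option autoImplicit false
-- summit-side namespace `Summit.BirchSwinnertonDyer.BirchSwinnertonDyer.…` (single-conjunct summit, D-0017 layout)
set_option linter.dupNamespace false

noncomputable section

open scoped Classical
open NumberField WeierstrassCurve DirichletCharacter Literature.NumberTheory.LFunctions
  Literature.NumberTheory.EllipticCurves Literature.NumberTheory.EllipticCurves.KrizLi2019
  Literature.NumberTheory.EllipticCurves.Rank1Residual

namespace Summit.BirchSwinnertonDyer.BirchSwinnertonDyer.Cruxes.BottomClassIndexLawFiveLe.LegendreHalfTransfer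

open Summit.BirchSwinnertonDyer.BirchSwinnertonDyer.Theorems.PrintCFram
open Summit.BirchSwinnertonDyer.BirchSwinnertonDyer.Theorems.PrintCFram.HeegnerFieldSupply
open Summit.BirchSwinnertonDyer.Rank1Residual.X12.O11

/-! ## Stubs of the line (six; four VERBATIM from registry v20, two new analytic ones replacing v20's `stub_bernoulliSupplySix`) -/

/-- `stub_prints5` — VERBATIM registry v20 (PRINT): the five refereed named facts (Hsieh 2014 Thm. A any level; Liu–Zhang–Zhang 2018
Thms 1.5.1/1.5.3 additive; the toric published inputs; the CM rank-zero BSD triple; Mazur–Wiles 1984 Thm. 2). Print, not research.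
[cite: Hsieh2014, Thm. A] [cite: LiuZhangZhang2018, Thm 1.5.1 and Thm 1.5.3] [cite: BurungaleFlach2024, Cor. 2] [cite: MazurWiles1984, Thm. 2 (p. 216)] -/
theorem stub_prints5 :
    (Hsieh2014.thmA_exists_isHsiehLFunction_unrPeriod_anyLevel ∧
      LiuZhangZhang2018.thm151_thm153_modularCurve_heegnerVector_additive ∧
      Summit.BirchSwinnertonDyer.BirchSwinnertonDyer.Theses.UniversalToricDescent.ToricPublishedInputs ∧
      bsdTriple_of_hasCM_of_L_one_ne_zero) ∧
    Literature.NumberTheory.NumberFields.MazurWiles1984.thm2_card_oddChiClassGroup_eq_bernoulli := by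
  sorry

/-- `stub_krizLi` — VERBATIM registry v20 (PRINT): Kriz–Li 2019 Thm. 1.20 (named fact). [cite: KrizLi2019, Thm. 1.20 (pp. 7–8)] -/
theorem stub_krizLi : KrizLi2019.thm120_padicLogHeegner_unit_of_bernoulli := by
  sorry

/-- `stub_bsdp_of_level` (B1-level) — VERBATIM registry v20 (RESEARCH, arithmetic, character-free): `BSD_p` for every rank-one class member
whose generator is `p`-divisible in `W(ℚ_p)` (the crux's level binder `n ≥ 1`; inhabited: 17424bl1@11, 305809c1@7). Untouched by this line; barrier
`CMRankOneAtRamifiedPrime` (BKNO 2026 §1.4). [cite: BurungaleKobayashiNakamuraOta2026, §1.4] -/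
theorem stub_bsdp_of_level :
    ∀ (W : WeierstrassCurve ℚ) [W.IsElliptic] [W.IsGloballyMinimal] (p : ℕ) [Fact p.Prime],
      W.HasCM → CMRamified W p → 5 ≤ p → W.analyticRank = 1 →
      ∀ P : W.toAffine.Point, ¬ IsOfFinAddOrder P →
        (∀ R : W.toAffine.Point, ∃ (k : ℤ) (T : W.toAffine.Point), IsOfFinAddOrder T ∧ R = k • P + T) →
        (∃ Q : (W.baseChange ℚ_[p]).toAffine.Point, p • Q = W.toPadicPoint p P) →
        BSDp W p := by
  sorry

/-- `stub_bsdp_of_sha` (B1-sha) — VERBATIM registry v20 (RESEARCH, arithmetic, character-free): `BSD_p` for every rank-one class member with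
`Ш(W/ℚ)[p] ≠ 0`. Untouched by this line; barrier `CMRankOneAtRamifiedPrime`. [cite: BurungaleKobayashiNakamuraOta2026, §1.4] -/
theorem stub_bsdp_of_sha :
    ∀ (W : WeierstrassCurve ℚ) [W.IsElliptic] [W.IsGloballyMinimal] (p : ℕ) [Fact p.Prime],
      W.HasCM → CMRamified W p → 5 ≤ p → W.analyticRank = 1 →
      (∃ s ∈ W.sha, s ≠ 0 ∧ p • s = 0) → BSDp W p := by
  sorry

/-- `stub_seedAwayFromP_offD` **(T_A off `D_p`, g15 v3; label DEVICE-M — a named, written-down argument, NOT a citation: P4 file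
`Lines/legendre-half-transfer-P4.md` §F.2 + §F.6)** — T_A (below) restricted to class conductors `m` with NO odd prime `q ∣ m`, `q ≡ ±1 (mod p)`.
DEVICE: the square-class component `R′ = Σ_{N ∈ class} H(k,N)q^N` of Cohen's `H_k` cut by the `U_q` / twist projectors (`q ∣ m`; level `4m²`-ish,
PRIME TO `p`) has cusp-`0` constant term `± 2^a · ζ(1−2k) · Π_{q ∣ m odd} ½(q−1)q^{−k−3/2}(q^{2k}−1) · [(2^{2k}−1)2^{−b}]_{2∣m}` (DERIVED for odd `q` in
P4 §F.6 from the theta multiplier + Gauss/Ramanujan sums; 2-part numerically certified at `k = 2..5`), CLASS-INDEPENDENT; since `4k ≡ 2 (mod p−1)`,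
`q^{2k} ≡ q·(q/p) (mod p)`, so it is a `p`-UNIT iff no odd `q ∣ m` has `q ≡ ±1 (mod p)` (`ζ(1−2k)` is a `p`-unit at all twelve `(p,k)`:
`num(B_{2k}/2k) mod p ∈ {6,1,1,2,1,16,25,40,55,49,145,43}`; `2^{2k} ≢ 1`). Multiply by `θ` (weight `k+1`, level `4m² ⊥ p`, integral
`q`-expansion principle), reduce mod `p`: a form with unit constant term is `≢ 0 (mod p)`; Bruinier 1999-type mod-`p` non-vanishing on
square classes away from the level (non-exceptional: `k ≢ 0, 1 (mod (p−1)/2)`) + Sturm give a fundamental `−d` in the class, `(d, pm) = 1`, every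
`q ∣ m` split in `ℚ(√−d)`, with `p ∤ H(k, |e*d|)`, i.e. a unit field factor — uniformly in `m`. Bookkeeping debts: `d = −3, −4` terms, non-fundamental
`N` (Hecke relation), the `2`-part constant. WINDOW: 58 of the 65 census classes lie here. Why it might fail: only through the bookkeeping (the
constant term is a unit by the displayed formula). -/
theorem stub_seedAwayFromP_offD :
    ∀ (p : ℕ) [Fact p.Prime] (m : ℕ) [NeZero m] (χ : DirichletCharacter ℚ_[p] m) (k : ℕ),
      (p = 7 ∨ p = 11 ∨ p = 19 ∨ p = 43 ∨ p = 67 ∨ p = 163) →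
      m.Coprime p → χ.IsPrimitive → χ.IsQuadratic → (k = (p + 1) / 4 ∨ k = (3 * p - 1) / 4) →
      2 ≤ k → k ≤ p - 2 → χ (-1) * (-1) ^ k = -1 →
      ¬ ‖((p - k : ℕ) : ℚ_[p])⁻¹ * generalizedBernoulli (p - k) χ‖ ≤ (p : ℝ)⁻¹ →
      ¬ (∃ q : ℕ, q.Prime ∧ q ∣ m ∧ q ≠ 2 ∧ (q % p = 1 ∨ q % p = p - 1)) →
      ∃ (K : Type) (_ : Field K) (_ : NumberField K) (εK : DirichletCharacter ℚ_[p] (NumberField.discr K).natAbs),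
        IsImaginaryQuadratic K ∧
        (∀ q : ℕ, q.Prime → q ∣ m → ((Ideal.span {(q : ℤ)}).primesOver (𝓞 K)).ncard = 2) ∧
        Odd (NumberField.discr K) ∧ NumberField.discr K < -4 ∧ IsKroneckerCharacterOf K εK ∧
        ¬ ‖(k : ℚ_[p])⁻¹ * @generalizedBernoulli ℚ_[p] _ _
            (changeLevel (dvd_mul_right m (NumberField.discr K).natAbs) χ *
              changeLevel (dvd_mul_left (NumberField.discr K).natAbs m) εK).conductor ⟨conductor_ne_zero _⟩ k
            (changeLevel (dvd_mul_right m (NumberField.discr K).natAbs) χ *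
              changeLevel (dvd_mul_left (NumberField.discr K).natAbs m) εK).primitiveCharacter‖ ≤ (p : ℝ)⁻¹ := by
  sorry

/-- `stub_seedAwayFromP_onD` **(T_A on `D_p`, g15 v3; label RESEARCH-S — no device in hand, statement not in print)** — T_A restricted to class
conductors `m` having an odd prime `q ∣ m` with `q ≡ ±1 (mod p)`. Here the class form of `stub_seedAwayFromP_offD` is CUSPIDAL mod `p` at every
cusp (P4 §F.1(b'), F.6 (vi)): the constant-term device is silent, and `D_p` is NOT thin (`|D_7 ∩ [−200,200]| = 28/107` admissible `e*`;
complement density `≍ (log X)^{−2/(p−1)}`). WINDOW: 7 of the 65 census classes (p = 7: `e* ∈ {−39, −43, −52, −71, −83, −87}`; p = 19: `e* = 37`),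
each with an explicit seed `|d| ≤ 71` (P4 §D) — so the finite window is decided; the ∀-`m` statement is the research. CANDIDATE SECOND DEVICE
(research, P4 §F.5): Kummer `(1−χ_E(p)p^{k−1})B_{k,χ_E}/k ≡ B_{1,χ_E·ω^{k−1}} (mod 𝔭)` puts the statement in the shape of Wiles 2015
Thm. 0.0.1′ (imaginary quadratic fields with prescribed splitting and `l ∤ h`) for the TAME NON-QUADRATIC character `χ_E·ω^{k−1}`; Wiles's theorem
covers quadratic characters only (and at `k = 1` its hypotheses (b)/(c) are exactly the CT-degeneracy conditions `q ≡ ±1 (mod l)` of the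
off-level family, P4 §F.5; Beckwith–Raum–Richter 2023 Thm. 1 removes (b) at `k = 1` in the non-holomorphic case only; and BRUINIER 1999's own
class-number theorem with prescribed local conditions at `S` holds exactly under «`q ≢ 0, ±1 (mod l)` for all `q ∈ S`» [corpus: Wiles 2015 p. 2] — the
same exclusion `D_p` one weight-family down: this stub is the KNOWN FRONTIER of the half-integral-weight method, P4 §F.8). Why it might fail: a genuine
Ramanujan-type congruence of the cuspidal-mod-`p` class form on the whole split-class — none seen (`0/1202` classes in the off-level family,
all window classes seeded). [cite: Wiles2015ClassGroups, Thm. 0.0.1, 0.0.1′] [cite: BeckwithRaumRichter2023, Thm. 1] -/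
theorem stub_seedAwayFromP_onD :
    ∀ (p : ℕ) [Fact p.Prime] (m : ℕ) [NeZero m] (χ : DirichletCharacter ℚ_[p] m) (k : ℕ),
      (p = 7 ∨ p = 11 ∨ p = 19 ∨ p = 43 ∨ p = 67 ∨ p = 163) →
      m.Coprime p → χ.IsPrimitive → χ.IsQuadratic → (k = (p + 1) / 4 ∨ k = (3 * p - 1) / 4) →
      2 ≤ k → k ≤ p - 2 → χ (-1) * (-1) ^ k = -1 →
      ¬ ‖((p - k : ℕ) : ℚ_[p])⁻¹ * generalizedBernoulli (p - k) χ‖ ≤ (p : ℝ)⁻¹ →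
      (∃ q : ℕ, q.Prime ∧ q ∣ m ∧ q ≠ 2 ∧ (q % p = 1 ∨ q % p = p - 1)) →
      ∃ (K : Type) (_ : Field K) (_ : NumberField K) (εK : DirichletCharacter ℚ_[p] (NumberField.discr K).natAbs),
        IsImaginaryQuadratic K ∧
        (∀ q : ℕ, q.Prime → q ∣ m → ((Ideal.span {(q : ℤ)}).primesOver (𝓞 K)).ncard = 2) ∧
        Odd (NumberField.discr K) ∧ NumberField.discr K < -4 ∧ IsKroneckerCharacterOf K εK ∧
        ¬ ‖(k : ℚ_[p])⁻¹ * @generalizedBernoulli ℚ_[p] _ _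
            (changeLevel (dvd_mul_right m (NumberField.discr K).natAbs) χ *
              changeLevel (dvd_mul_left (NumberField.discr K).natAbs m) εK).conductor ⟨conductor_ne_zero _⟩ k
            (changeLevel (dvd_mul_right m (NumberField.discr K).natAbs) χ *
              changeLevel (dvd_mul_left (NumberField.discr K).natAbs m) εK).primitiveCharacter‖ ≤ (p : ℝ)⁻¹ := by
  sorry

/-- `seedAwayFromP_of_dichotomy` **(T_A; g15 v3: DERIVED by case split from `stub_seedAwayFromP_offD` (DEVICE-M) and `stub_seedAwayFromP_onD`
(RESEARCH-S) on the decidable predicate `D_p(m)` := «some odd prime `q ∣ m` has `q ≡ ±1 (mod p)`»; v2 label RESEARCH-S/M, V#131 P1)** — the curve-free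
supply statement `(P⁶)` of w8 g4 with the splitting condition imposed ONLY at the primes of the class conductor `m` (no condition at `p`): for each
leaf prime `p`, primitive quadratic `χ` mod `m ⊥ p`, `k ∈ {(p+1)/4, (3p−1)/4}` with the sign condition and a unit class factor, SOME imaginary
quadratic `K₀` with every `q ∣ m` split, `d_{K₀}` odd `< −4`, a Kronecker character `ε_{K₀}`, and a `p`-adic unit field factor `B_{k,(χ ε_{K₀})~}/k`.
Level prime to `p` throughout (integral `q`-expansion principle available). WHY IT IS NOT A CITATION (critic V#131 (4)(ii)): Bruinier 1999 Thm. 1 /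
Ono–Skinner 1998 prescribe Legendre symbols only at primes `∤ 2Nℓ`, whereas T_A's splitting primes `q ∣ m` DIVIDE the level `4m'²` of the square-class
component; Wiles 2015 Thm. 0.0.1 / Beckwith 2017 Thm. 1.1 allow an arbitrary finite set of local conditions but only at `k = 1` (weight 3/2); Byeon 2003
(weight 5/2) has no local conditions — so «T_A = Bruinier + CRT» is FALSE and T_A is one rung above print. INTENDED PROOF (named, size M): write the
square-class component `F_{e*,c} = Σ_{N ∈ c} H(k,N) q^N` of Cohen's `H_k` (projector = a character sum of twists by characters mod `m'`, level
`Γ₀(4m'²)`, still prime to `p`); compute its CONSTANT TERMS at the cusps of `Γ₀(4m'²)` from Cohen's Eisenstein description of `H_k` (they are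
`ζ(1−2k)`-multiples of Gauss-sum expressions; `ζ(1−2k)` is a `p`-unit at all twelve `(p, k)`: the only irregular pair nearby is `(67, 58) ≠ (67, 2k)`);
a non-zero constant term mod `p` at one cusp gives `F_{e*,c} ≢ 0 (mod p)`, and Sturm's bound then yields some `N = |e*·d| ≤ (k+1/2)[Γ₀(4):Γ₀(4m'²)]/12`
in the class with `p ∤ H(k,N)`; the bookkeeping must dispose of the `d = −3, −4` terms and of non-fundamental `N` (Hecke relation `T_k(f)`).
INTENT LINE (V#131 P3): the TYPE admits `m = 1` with `χ` trivial (Mathlib's character mod 1 is primitive and quadratic); this is INTENDED and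
harmless — it is the sub-case `e* = 1` of w8 g4's `(P⁶)` VERBATIM (registry v20 `stub_bernoulliSupplySix` has the same binders), the sign condition
then forces `k` odd, and the critic checked the hypothesis non-vacuous and the conclusion true at all six leaf primes (e.g. `(p,k) = (7,5)`: `D = −7`,
split `D = −19`). Why it might fail as stated: only if some class character has NO admissible `K₀` at all, against all numerics (g12: 63/63 classes,
w8 g4: 52 rows, g14: all `|e*| ≤ 40`, `p ≤ 19`, first or second admissible `d`). Strictly weaker than `(P⁶)`. -/
theorem seedAwayFromP_of_dichotomy :
    ∀ (p : ℕ) [Fact p.Prime] (m : ℕ) [NeZero m] (χ : DirichletCharacter ℚ_[p] m) (k : ℕ),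
      (p = 7 ∨ p = 11 ∨ p = 19 ∨ p = 43 ∨ p = 67 ∨ p = 163) →
      m.Coprime p → χ.IsPrimitive → χ.IsQuadratic → (k = (p + 1) / 4 ∨ k = (3 * p - 1) / 4) →
      2 ≤ k → k ≤ p - 2 → χ (-1) * (-1) ^ k = -1 →
      ¬ ‖((p - k : ℕ) : ℚ_[p])⁻¹ * generalizedBernoulli (p - k) χ‖ ≤ (p : ℝ)⁻¹ →
      ∃ (K : Type) (_ : Field K) (_ : NumberField K) (εK : DirichletCharacter ℚ_[p] (NumberField.discr K).natAbs),
        IsImaginaryQuadratic K ∧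
        (∀ q : ℕ, q.Prime → q ∣ m → ((Ideal.span {(q : ℤ)}).primesOver (𝓞 K)).ncard = 2) ∧
        Odd (NumberField.discr K) ∧ NumberField.discr K < -4 ∧ IsKroneckerCharacterOf K εK ∧
        ¬ ‖(k : ℚ_[p])⁻¹ * @generalizedBernoulli ℚ_[p] _ _
            (changeLevel (dvd_mul_right m (NumberField.discr K).natAbs) χ *
              changeLevel (dvd_mul_left (NumberField.discr K).natAbs m) εK).conductor ⟨conductor_ne_zero _⟩ k
            (changeLevel (dvd_mul_right m (NumberField.discr K).natAbs) χ *
              changeLevel (dvd_mul_left (NumberField.discr K).natAbs m) εK).primitiveCharacter‖ ≤ (p : ℝ)⁻¹ := by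
  intro p _ m _ χ k hp hm hχ hq hk h2 hkp hsign hunit
  by_cases hD : (∃ q : ℕ, q.Prime ∧ q ∣ m ∧ q ≠ 2 ∧ (q % p = 1 ∨ q % p = p - 1))
  · exact stub_seedAwayFromP_onD p m χ k hp hm hχ hq hk h2 hkp hsign hunit hD
  · exact stub_seedAwayFromP_offD p m χ k hp hm hχ hq hk h2 hkp hsign hunit hD

/-- `stub_legendreHalfTransfer` **(T_B, new; the load-bearing stub of v1; label after V#131 P2: RESEARCH-L — no printed theorem applies verbatim;
label after LEAD g12's report §3.4 (2026-08-29, θ-cycle PROPOSITION, checked line by line by this seat in `Lines/legendre-half-transfer-P4.md` §C):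
DERIVED = (AtP⁶) = the planned `stub_atP` of registry v21 — the `θ_K` exception below is AVOIDED BY WEIGHT: `Φ₀ = G·θ₀^p` has weight `κ = k+(p+1)/2`,
and a half-supported in-cycle form at `Φ₀`'s residue offset `(p+1)/4` past a low point needs filtration `≥ (p+3)/2 + (p+1)²/4 > 7(p+1)/4 = w(ΘΦ₀)`
(`k = (p+1)/4`), resp. `w(ΘΦ₀) mod p ∈ {(p+5)/4,(p+9)/4}` lies in the forbidden band `[1,(p+1)/2]` (`k = (3p−1)/4`); typing debt only: mod-`p` modular
forms of half-integral weight on `Γ₁(4N)`, `Θ`, filtration — Katz 1977, Jochnowitz 1982, Serre 1973, Cohen 1975, Shimura 1973)** —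
LEGENDRE-HALF TRANSFER: at the same parameters, a unit field factor on SOME admissible `K₀` (every `q ∣ m` split; nothing asked at `p`) forces a unit
field factor on an admissible `K` in which, in addition, `p` SPLITS. Mechanism (informal): «`p` split in `K = ℚ(√D)`» ⟺ `(N/p) = (e*/p)` for the index
`N = |e*·D|` of the Cohen–Eisenstein series `H_k` (weight `k + 1/2`, level 4); `(N/p) ≡ N^{(p−1)/2} (mod p)` makes the Legendre-half projector
`½(1 ± εθ^{(p−1)/2})` available MOD `p` at level PRIME TO `p` (Serre–Katz `θ`), so `¬T_B` at one `(p, e*, k)` is a Ramanujan-type congruence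
`a(pn+b) ≡ 0 (mod p)`, `p ∤ b`, for a non-zero square-class component of `H_k` (propagating to the whole Legendre half).
THE EXCEPTION, PRECISELY (critic V#131 (2), (4)(i)). In integral weight and level prime to `p`, a form `f ≢ 0 (mod p)` supported on one Legendre
class `{(n/p) ≠ −ε}` exists first at filtration `w = (p+1)/2`: `E_{(p+1)/2} ≡ θ_K (mod p)` with `θ_K = ½ Σ_{𝔞} q^{N𝔞}` the weight-one theta series of
`K = ℚ(√−p)` — and `ℚ(√−p)` IS THIS CRUX'S OWN CM FIELD (the leaf primes are exactly the `p ≡ 3 (4)` with `h(−p) = 1`); `θ_K` is supported on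
`(n/p) ≠ −1`. The Shimura weight `2k` of our `k ∈ {(p+1)/4, (3p−1)/4}` is `≡ (p+1)/2 (mod p−1)` — the weight of `θ_K`. Its HALF-INTEGRAL SHADOW
exists too: any form congruent mod `p` to (a square-class piece of) `θ_K · g` with `g` of integral weight and `p`-unit leading behaviour is
half-supported, so «both Legendre halves of a low-filtration form are non-zero» is FALSE as a general principle at our weight; what T_B needs is the
statement for the specific EISENSTEIN components `F_{e*,c}` of `H_k`. The printed half-support theorems do NOT apply verbatim either way: Bruinier 1999
Thm. 1 / Bruinier–Ono 2003 / Ahlgren–Boylan 2005 constrain half-support at a prime `≠` the modulus or are stated for CUSP forms (`S_{λ+1/2}`), and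
Ahlgren–Boylan 2003 Thm. 3 (half-support AT `ℓ` restricts `λ (mod ℓ−1)`; Invent. 153, not held — acq-14325) is a cusp-form statement whose
exceptional weights include ours; `H_k`'s components are NON-cuspidal. At `k = 1` (Hurwitz class numbers, the mock-modular analogue) the literature
decides exactly this much [corpus: paper:arxiv-2203.11273 pp. 2–3]: Beckwith–Raum–Richter 2022 Thm. 1 — for `ℓ > 3`, `−b ≡ □ (mod a)` and
`H(an+b) ≡ 0 (mod ℓ)` for all `n` force `ℓ ∣ b` (and `ℓ ∣ a`, BRR 2020), which EXCLUDES our shape (`a = p·m'·c`, `ℓ = p`, `p ∤ b`) in the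
non-holomorphic case; Thm. 2 — square-class propagation `b ↦ bu²`, `(u,a) = 1`; Thm. 3 — maximal congruences have `ord_q(a/gcd(a,b)) ≤ 1` (odd `q`),
`≤ 3` (`q = 2`); Thm. 4 — DICHOTOMY: a congruence on `aℤ+b` is either «`ℓ ∣ h(−D)` for EVERY fundamental `−D < −4` with `Df² ∈ aℤ+b`» (BRR: «we do not
expect that the first case ever occurs» — NOT proved; Wiles 2015 only forces `q ≡ ±1 (mod ℓ)` for odd `q` with `2 ∤ ord_q(a)`) or the Hecke-eigenvalue
identity `σ₁(f_q) ≡ (−D/q)σ₁(f_q/q) (mod ℓ)` at some `q ∣ a` (NON-fundamental classes only — the shape of every trivial candidate our numerics found at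
`k ≥ 2`: `p = 7`: `N ≡ 4, 28 (32)`; `p = 11`: `N ≡ 9, 18 (27)`). So even at `k = 1` the first branch — the analogue of `¬T_B` — is open in print; Raum
2022 Thm. 1 / §4.1 (arXiv:2010.06272) and Raum 2023 (Forum Math., doi:10.1515/forum-2022-0041; not held, acq-14338) give the structure theory
(`U_ℓ`/`θ`-type, «gargantuan weight») this line would run for `F_{e*,c}`. KUMMER TWIN (critic, free): `B_{k,χ}/k ≡ B_{k′,χ·ε_{−p}}/k′ (mod p)` with
`k′ = k + (p−1)/2 = (3p−1)/4` ties the two admissible weights (`D ↦ −pD`), so ONE weight per `p` carries the content and the twin column of the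
numerics is not independent evidence. Why it might fail: an Eisenstein square-class component of `H_k` congruent to a `θ_K`-type half-supported form
at one `(p, e*)`. Numerics v2 (`cohen_fft.py`, all twelve `(p,k)`; `p ≤ 67`: `N ≤ 2·10⁵`, `m' ≤ 200` (`186` at `p = 67`); `p = 163`: `N ≤ 1.2·10⁵/5·10⁴`,
`m' ≤ 40/12`): 0 genuine congruences (all 1188 primitive candidates are Hecke-type, on classes with no fundamental member), 0 one-sided square classes. Strictly weaker than `(P⁶)`; `T_A ∧ T_B ⟺ (P⁶)` given
T_A's witnesses. -/
theorem stub_legendreHalfTransfer :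
    ∀ (p : ℕ) [Fact p.Prime] (m : ℕ) [NeZero m] (χ : DirichletCharacter ℚ_[p] m) (k : ℕ),
      (p = 7 ∨ p = 11 ∨ p = 19 ∨ p = 43 ∨ p = 67 ∨ p = 163) →
      m.Coprime p → χ.IsPrimitive → χ.IsQuadratic → (k = (p + 1) / 4 ∨ k = (3 * p - 1) / 4) →
      2 ≤ k → k ≤ p - 2 → χ (-1) * (-1) ^ k = -1 →
      ¬ ‖((p - k : ℕ) : ℚ_[p])⁻¹ * generalizedBernoulli (p - k) χ‖ ≤ (p : ℝ)⁻¹ →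
      (∃ (K : Type) (_ : Field K) (_ : NumberField K) (εK : DirichletCharacter ℚ_[p] (NumberField.discr K).natAbs),
        IsImaginaryQuadratic K ∧
        (∀ q : ℕ, q.Prime → q ∣ m → ((Ideal.span {(q : ℤ)}).primesOver (𝓞 K)).ncard = 2) ∧
        Odd (NumberField.discr K) ∧ NumberField.discr K < -4 ∧ IsKroneckerCharacterOf K εK ∧
        ¬ ‖(k : ℚ_[p])⁻¹ * @generalizedBernoulli ℚ_[p] _ _
            (changeLevel (dvd_mul_right m (NumberField.discr K).natAbs) χ *
              changeLevel (dvd_mul_left (NumberField.discr K).natAbs m) εK).conductor ⟨conductor_ne_zero _⟩ k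
            (changeLevel (dvd_mul_right m (NumberField.discr K).natAbs) χ *
              changeLevel (dvd_mul_left (NumberField.discr K).natAbs m) εK).primitiveCharacter‖ ≤ (p : ℝ)⁻¹) →
      ∃ (K : Type) (_ : Field K) (_ : NumberField K) (εK : DirichletCharacter ℚ_[p] (NumberField.discr K).natAbs),
        IsImaginaryQuadratic K ∧
        (∀ q : ℕ, q.Prime → q ∣ p * m → ((Ideal.span {(q : ℤ)}).primesOver (𝓞 K)).ncard = 2) ∧
        Odd (NumberField.discr K) ∧ NumberField.discr K < -4 ∧ IsKroneckerCharacterOf K εK ∧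
        ¬ ‖(k : ℚ_[p])⁻¹ * @generalizedBernoulli ℚ_[p] _ _
            (changeLevel (dvd_mul_right m (NumberField.discr K).natAbs) χ *
              changeLevel (dvd_mul_left (NumberField.discr K).natAbs m) εK).conductor ⟨conductor_ne_zero _⟩ k
            (changeLevel (dvd_mul_right m (NumberField.discr K).natAbs) χ *
              changeLevel (dvd_mul_left (NumberField.discr K).natAbs m) εK).primitiveCharacter‖ ≤ (p : ℝ)⁻¹ := by
  sorry

/-! ## Kernel (sorry-free): T_A ∧ T_B ⟹ (P⁶) ⟹ Stub C ⟹ (with the four verbatim v20 stubs) the crux BY NAME -/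

/-- **`(T_A ∧ T_B) ⟹ (P⁶)`** — pure logic: feed T_A's witness into T_B. -/
theorem splitPrimes_six_of_seed_of_transfer
    (hA : ∀ (p : ℕ) [Fact p.Prime] (m : ℕ) [NeZero m] (χ : DirichletCharacter ℚ_[p] m) (k : ℕ),
      (p = 7 ∨ p = 11 ∨ p = 19 ∨ p = 43 ∨ p = 67 ∨ p = 163) →
      m.Coprime p → χ.IsPrimitive → χ.IsQuadratic → (k = (p + 1) / 4 ∨ k = (3 * p - 1) / 4) →
      2 ≤ k → k ≤ p - 2 → χ (-1) * (-1) ^ k = -1 →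
      ¬ ‖((p - k : ℕ) : ℚ_[p])⁻¹ * generalizedBernoulli (p - k) χ‖ ≤ (p : ℝ)⁻¹ →
      ∃ (K : Type) (_ : Field K) (_ : NumberField K) (εK : DirichletCharacter ℚ_[p] (NumberField.discr K).natAbs),
        IsImaginaryQuadratic K ∧
        (∀ q : ℕ, q.Prime → q ∣ m → ((Ideal.span {(q : ℤ)}).primesOver (𝓞 K)).ncard = 2) ∧
        Odd (NumberField.discr K) ∧ NumberField.discr K < -4 ∧ IsKroneckerCharacterOf K εK ∧
        ¬ ‖(k : ℚ_[p])⁻¹ * @generalizedBernoulli ℚ_[p] _ _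
            (changeLevel (dvd_mul_right m (NumberField.discr K).natAbs) χ *
              changeLevel (dvd_mul_left (NumberField.discr K).natAbs m) εK).conductor ⟨conductor_ne_zero _⟩ k
            (changeLevel (dvd_mul_right m (NumberField.discr K).natAbs) χ *
              changeLevel (dvd_mul_left (NumberField.discr K).natAbs m) εK).primitiveCharacter‖ ≤ (p : ℝ)⁻¹)
    (hB : ∀ (p : ℕ) [Fact p.Prime] (m : ℕ) [NeZero m] (χ : DirichletCharacter ℚ_[p] m) (k : ℕ),
      (p = 7 ∨ p = 11 ∨ p = 19 ∨ p = 43 ∨ p = 67 ∨ p = 163) →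
      m.Coprime p → χ.IsPrimitive → χ.IsQuadratic → (k = (p + 1) / 4 ∨ k = (3 * p - 1) / 4) →
      2 ≤ k → k ≤ p - 2 → χ (-1) * (-1) ^ k = -1 →
      ¬ ‖((p - k : ℕ) : ℚ_[p])⁻¹ * generalizedBernoulli (p - k) χ‖ ≤ (p : ℝ)⁻¹ →
      (∃ (K : Type) (_ : Field K) (_ : NumberField K) (εK : DirichletCharacter ℚ_[p] (NumberField.discr K).natAbs),
        IsImaginaryQuadratic K ∧
        (∀ q : ℕ, q.Prime → q ∣ m → ((Ideal.span {(q : ℤ)}).primesOver (𝓞 K)).ncard = 2) ∧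
        Odd (NumberField.discr K) ∧ NumberField.discr K < -4 ∧ IsKroneckerCharacterOf K εK ∧
        ¬ ‖(k : ℚ_[p])⁻¹ * @generalizedBernoulli ℚ_[p] _ _
            (changeLevel (dvd_mul_right m (NumberField.discr K).natAbs) χ *
              changeLevel (dvd_mul_left (NumberField.discr K).natAbs m) εK).conductor ⟨conductor_ne_zero _⟩ k
            (changeLevel (dvd_mul_right m (NumberField.discr K).natAbs) χ *
              changeLevel (dvd_mul_left (NumberField.discr K).natAbs m) εK).primitiveCharacter‖ ≤ (p : ℝ)⁻¹) →
      ∃ (K : Type) (_ : Field K) (_ : NumberField K) (εK : DirichletCharacter ℚ_[p] (NumberField.discr K).natAbs),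
        IsImaginaryQuadratic K ∧
        (∀ q : ℕ, q.Prime → q ∣ p * m → ((Ideal.span {(q : ℤ)}).primesOver (𝓞 K)).ncard = 2) ∧
        Odd (NumberField.discr K) ∧ NumberField.discr K < -4 ∧ IsKroneckerCharacterOf K εK ∧
        ¬ ‖(k : ℚ_[p])⁻¹ * @generalizedBernoulli ℚ_[p] _ _
            (changeLevel (dvd_mul_right m (NumberField.discr K).natAbs) χ *
              changeLevel (dvd_mul_left (NumberField.discr K).natAbs m) εK).conductor ⟨conductor_ne_zero _⟩ k
            (changeLevel (dvd_mul_right m (NumberField.discr K).natAbs) χ *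
              changeLevel (dvd_mul_left (NumberField.discr K).natAbs m) εK).primitiveCharacter‖ ≤ (p : ℝ)⁻¹) :
    ∀ (p : ℕ) [Fact p.Prime] (m : ℕ) [NeZero m] (χ : DirichletCharacter ℚ_[p] m) (k : ℕ),
      (p = 7 ∨ p = 11 ∨ p = 19 ∨ p = 43 ∨ p = 67 ∨ p = 163) →
      m.Coprime p → χ.IsPrimitive → χ.IsQuadratic → (k = (p + 1) / 4 ∨ k = (3 * p - 1) / 4) →
      2 ≤ k → k ≤ p - 2 → χ (-1) * (-1) ^ k = -1 →
      ¬ ‖((p - k : ℕ) : ℚ_[p])⁻¹ * generalizedBernoulli (p - k) χ‖ ≤ (p : ℝ)⁻¹ →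
      ∃ (K : Type) (_ : Field K) (_ : NumberField K) (εK : DirichletCharacter ℚ_[p] (NumberField.discr K).natAbs),
        IsImaginaryQuadratic K ∧
        (∀ q : ℕ, q.Prime → q ∣ p * m → ((Ideal.span {(q : ℤ)}).primesOver (𝓞 K)).ncard = 2) ∧
        Odd (NumberField.discr K) ∧ NumberField.discr K < -4 ∧ IsKroneckerCharacterOf K εK ∧
        ¬ ‖(k : ℚ_[p])⁻¹ * @generalizedBernoulli ℚ_[p] _ _
            (changeLevel (dvd_mul_right m (NumberField.discr K).natAbs) χ *
              changeLevel (dvd_mul_left (NumberField.discr K).natAbs m) εK).conductor ⟨conductor_ne_zero _⟩ k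
            (changeLevel (dvd_mul_right m (NumberField.discr K).natAbs) χ *
              changeLevel (dvd_mul_left (NumberField.discr K).natAbs m) εK).primitiveCharacter‖ ≤ (p : ℝ)⁻¹ :=
  fun p _ m _ χ k h6 hmp hχ hχ2 hk hk2 hkp hsgn hcls ↦
    hB p m χ k h6 hmp hχ hχ2 hk hk2 hkp hsgn hcls (hA p m χ k h6 hmp hχ hχ2 hk hk2 hkp hsgn hcls)

/-- **Kernel of the line (v2): the crux `BottomClassIndexLawFiveLe` BY NAME from the six stub statements** — `stub_prints5`, `stub_krizLi`,
`stub_bsdp_of_level`, `stub_bsdp_of_sha` (registry v20 verbatim) and the two new analytic stubs T_A = `seedAwayFromP_of_dichotomy` (⟸ `stub_seedAwayFromP_offD` ∧ `stub_seedAwayFromP_onD`), T_B =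
`stub_legendreHalfTransfer`, via `splitPrimes_six_of_seed_of_transfer` ⟹ `(P⁶)` ⟹ Stub C (w8 g4's `HeegnerFieldSupply.stubC_of_splitPrimes_bernoulliUnit_six`,
p677555) ⟹ LEAD g11's END STATE in binders (`EisensteinEndStateV19Binders.bottomClassIndexLawFiveLe_of_prints4_of_mazurWiles_of_krizLi_of_cover_of_level_of_sha`,
p677037) — v20's composition with its `stub_bernoulliSupplySix` slot fed by T_A ∧ T_B. Sorry-free; conditional on its six hypotheses; BSD is not
proved by any of this. -/
theorem BottomClassIndexLawFiveLe_of
    (hprints5 :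
    (Hsieh2014.thmA_exists_isHsiehLFunction_unrPeriod_anyLevel ∧
      LiuZhangZhang2018.thm151_thm153_modularCurve_heegnerVector_additive ∧
      Summit.BirchSwinnertonDyer.BirchSwinnertonDyer.Theses.UniversalToricDescent.ToricPublishedInputs ∧
      bsdTriple_of_hasCM_of_L_one_ne_zero) ∧
    Literature.NumberTheory.NumberFields.MazurWiles1984.thm2_card_oddChiClassGroup_eq_bernoulli)
    (hKL : KrizLi2019.thm120_padicLogHeegner_unit_of_bernoulli)
    (hLevel :
    ∀ (W : WeierstrassCurve ℚ) [W.IsElliptic] [W.IsGloballyMinimal] (p : ℕ) [Fact p.Prime],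
      W.HasCM → CMRamified W p → 5 ≤ p → W.analyticRank = 1 →
      ∀ P : W.toAffine.Point, ¬ IsOfFinAddOrder P →
        (∀ R : W.toAffine.Point, ∃ (k : ℤ) (T : W.toAffine.Point), IsOfFinAddOrder T ∧ R = k • P + T) →
        (∃ Q : (W.baseChange ℚ_[p]).toAffine.Point, p • Q = W.toPadicPoint p P) →
        BSDp W p)
    (hSha :
    ∀ (W : WeierstrassCurve ℚ) [W.IsElliptic] [W.IsGloballyMinimal] (p : ℕ) [Fact p.Prime],
      W.HasCM → CMRamified W p → 5 ≤ p → W.analyticRank = 1 →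
      (∃ s ∈ W.sha, s ≠ 0 ∧ p • s = 0) → BSDp W p)
    (hA : ∀ (p : ℕ) [Fact p.Prime] (m : ℕ) [NeZero m] (χ : DirichletCharacter ℚ_[p] m) (k : ℕ),
      (p = 7 ∨ p = 11 ∨ p = 19 ∨ p = 43 ∨ p = 67 ∨ p = 163) →
      m.Coprime p → χ.IsPrimitive → χ.IsQuadratic → (k = (p + 1) / 4 ∨ k = (3 * p - 1) / 4) →
      2 ≤ k → k ≤ p - 2 → χ (-1) * (-1) ^ k = -1 →
      ¬ ‖((p - k : ℕ) : ℚ_[p])⁻¹ * generalizedBernoulli (p - k) χ‖ ≤ (p : ℝ)⁻¹ →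
      ∃ (K : Type) (_ : Field K) (_ : NumberField K) (εK : DirichletCharacter ℚ_[p] (NumberField.discr K).natAbs),
        IsImaginaryQuadratic K ∧
        (∀ q : ℕ, q.Prime → q ∣ m → ((Ideal.span {(q : ℤ)}).primesOver (𝓞 K)).ncard = 2) ∧
        Odd (NumberField.discr K) ∧ NumberField.discr K < -4 ∧ IsKroneckerCharacterOf K εK ∧
        ¬ ‖(k : ℚ_[p])⁻¹ * @generalizedBernoulli ℚ_[p] _ _
            (changeLevel (dvd_mul_right m (NumberField.discr K).natAbs) χ *
              changeLevel (dvd_mul_left (NumberField.discr K).natAbs m) εK).conductor ⟨conductor_ne_zero _⟩ k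
            (changeLevel (dvd_mul_right m (NumberField.discr K).natAbs) χ *
              changeLevel (dvd_mul_left (NumberField.discr K).natAbs m) εK).primitiveCharacter‖ ≤ (p : ℝ)⁻¹)
    (hB : ∀ (p : ℕ) [Fact p.Prime] (m : ℕ) [NeZero m] (χ : DirichletCharacter ℚ_[p] m) (k : ℕ),
      (p = 7 ∨ p = 11 ∨ p = 19 ∨ p = 43 ∨ p = 67 ∨ p = 163) →
      m.Coprime p → χ.IsPrimitive → χ.IsQuadratic → (k = (p + 1) / 4 ∨ k = (3 * p - 1) / 4) →
      2 ≤ k → k ≤ p - 2 → χ (-1) * (-1) ^ k = -1 →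
      ¬ ‖((p - k : ℕ) : ℚ_[p])⁻¹ * generalizedBernoulli (p - k) χ‖ ≤ (p : ℝ)⁻¹ →
      (∃ (K : Type) (_ : Field K) (_ : NumberField K) (εK : DirichletCharacter ℚ_[p] (NumberField.discr K).natAbs),
        IsImaginaryQuadratic K ∧
        (∀ q : ℕ, q.Prime → q ∣ m → ((Ideal.span {(q : ℤ)}).primesOver (𝓞 K)).ncard = 2) ∧
        Odd (NumberField.discr K) ∧ NumberField.discr K < -4 ∧ IsKroneckerCharacterOf K εK ∧
        ¬ ‖(k : ℚ_[p])⁻¹ * @generalizedBernoulli ℚ_[p] _ _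
            (changeLevel (dvd_mul_right m (NumberField.discr K).natAbs) χ *
              changeLevel (dvd_mul_left (NumberField.discr K).natAbs m) εK).conductor ⟨conductor_ne_zero _⟩ k
            (changeLevel (dvd_mul_right m (NumberField.discr K).natAbs) χ *
              changeLevel (dvd_mul_left (NumberField.discr K).natAbs m) εK).primitiveCharacter‖ ≤ (p : ℝ)⁻¹) →
      ∃ (K : Type) (_ : Field K) (_ : NumberField K) (εK : DirichletCharacter ℚ_[p] (NumberField.discr K).natAbs),
        IsImaginaryQuadratic K ∧
        (∀ q : ℕ, q.Prime → q ∣ p * m → ((Ideal.span {(q : ℤ)}).primesOver (𝓞 K)).ncard = 2) ∧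
        Odd (NumberField.discr K) ∧ NumberField.discr K < -4 ∧ IsKroneckerCharacterOf K εK ∧
        ¬ ‖(k : ℚ_[p])⁻¹ * @generalizedBernoulli ℚ_[p] _ _
            (changeLevel (dvd_mul_right m (NumberField.discr K).natAbs) χ *
              changeLevel (dvd_mul_left (NumberField.discr K).natAbs m) εK).conductor ⟨conductor_ne_zero _⟩ k
            (changeLevel (dvd_mul_right m (NumberField.discr K).natAbs) χ *
              changeLevel (dvd_mul_left (NumberField.discr K).natAbs m) εK).primitiveCharacter‖ ≤ (p : ℝ)⁻¹) :
    Summit.BirchSwinnertonDyer.BirchSwinnertonDyer.Theses.PrintCFram.BottomClassIndexLawFiveLe :=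
  EisensteinEndStateV19Binders.bottomClassIndexLawFiveLe_of_prints4_of_mazurWiles_of_krizLi_of_cover_of_level_of_sha
    hprints5.1 hprints5.2 hKL (stubC_of_splitPrimes_bernoulliUnit_six (splitPrimes_six_of_seed_of_transfer hA hB)) hLevel hSha

/-- The crux from the seven theorem-shaped stubs (this is where the `sorry`s enter; the kernel above is sorry-free). -/
theorem BottomClassIndexLawFiveLe_of_stubs :
    Summit.BirchSwinnertonDyer.BirchSwinnertonDyer.Theses.PrintCFram.BottomClassIndexLawFiveLe :=
  BottomClassIndexLawFiveLe_of stub_prints5 stub_krizLi stub_bsdp_of_level stub_bsdp_of_sha seedAwayFromP_of_dichotomy stub_legendreHalfTransfer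

end Summit.BirchSwinnertonDyer.BirchSwinnertonDyer.Cruxes.BottomClassIndexLawFiveLe.LegendreHalfTransfer
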